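import Literature.Topology.FourManifolds.CircleFramingClassification
import Literature.Topology.FourManifolds.CircleSurgeryConnectedSum
import Literature.Topology.FourManifolds.ProjectivePlaneSummandOdd
import Literature.Topology.Euclidean.InvarianceOfDomain
import HarnessLib

/-!
# The twisted surgery along the trivial circle contains `ℂℙ² ∖ {pt}`; its intersection form is odd

Topic `Literature/Topology/FourManifolds` (barrier seat
`provefact-Literature.Barriers.SmoothPoincare4.Stab-ad8c696e34`, seat 0).  R. C. Kirby, *The
Topology of 4-Manifolds*, LNM 1374 (1989), Ch. VIII p. 50 (and Ch. X p. 55): attaching a 2-handle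
to a trivial circle in a chart of a 4-manifold `M` changes `M` *"by connected sum with either
`S² × S²` or `S² ×~ S²`"* according to the framing, `π₁(SO(3)) = ℤ/2`; and Ch. I §3, p. 10 with
R. Gompf, A. Stipsicz, *4-Manifolds and Kirby Calculus* (1999), §1.2 and §5.2:
`S² ×~ S² ≅ ℂℙ² # \overline{ℂℙ²}` has the ODD intersection form `⟨1⟩ ⊕ ⟨-1⟩`.  The tree's
rendering of the two framings is the dichotomy
`Literature.Topology.FourManifolds.IsCircleSurgery.isConnectedSum_or_twist`
(`CircleSurgeryDichotomy.lean`): a surgery along a null-homotopic circle of a simply connected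
closed 4-manifold `X` is `X # S² × S²`, or the surgery along the standard circle of a chart
`C : StdChart X` with the standard tube reframed by the generator
`Literature.Topology.FourManifolds.OpLoop.twist` of `π₁ SO(3)` — the manifold
`(C.nbhd.linTwist OpLoop.twist).Surgered`.  This file proves that **the twisted surgery has an
odd intersection form**, for every closed smooth 4-manifold `X` and every chart `C`
(`isOdd_intersectionForm_twistSurgered`), which is the local input `hodd` of the parity route to
Wall's stabilisation theorem and to `StableBarrierFour`
(`HCobordismEvenLevels.lean`, `StableInvariantsBlindParity.lean`).

## Proof: an explicit open embedding `ℂℙ² ∖ {[0:0:1]} ↪ P`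

Let `P` be any open gluing of `X ∖ c` and `D̊² × S²` along the surgery relation of the twisted
tube `ν = C.nbhd.linTwist twist` (`jA (ν (u, t v)) = jB (t u, v)`, `0 < t < 1`; in terms of the
untwisted tube of the chart, `jA (C.igPH (tubeMap (u, t R_u v))) = jB (t u, v)` with `R_u` the
rotation of the `(w₀, w₁)`-plane by the angle of `u`).  The loop `twist` rotates about the
`w₂`-axis, and `w₂` is the radial direction of the standard tube
`tubeMap (u, w) = (u, w₀, w₁)/(√(1 + |w|²) - w₂)` (`CircleSurgeryStandardModel.lean`): the flat
disc `D` bounded by the standard circle approaches it from the direction `-e₂`, FIXED by the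
rotations, so that `jA (D ∖ c)` closes up smoothly at the single point `jB (0, -e₂)` of the belt
sphere to a 2-sphere `F ⊆ P`, whose normal bundle is clutched by `u ↦ R_u`, i.e. has Euler number
`±1`; a tubular neighbourhood of `F` is the total space of `𝒪(1) → ℂℙ¹`, that is
`ℂℙ² ∖ {pt}`.  Explicitly, with `σ : ℂ → S² ∖ {e₂}` the inverse stereographic projection from
`e₂` (`σ 0 = -e₂`, `R_u σ(ζ) = σ(u ζ)`) and
`Φ (a, b) = (a, σ₀, σ₁)/(√(1 + |a|²) - σ₂)`, `σ = σ (b / max (1, |a|))` — a continuous injection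
`ℂ² → ℝ⁴ ∖ C₁` which for `a ≠ 0` equals `tubeMap (a/|a|, |a|⁻¹ σ)` — the map

  `j [z₀ : z₁ : z₂] = jA (C.igPH (Φ (z₁/z₀, z₂/z₀)))`            on `{z₀ ≠ 0}`,
  `j [z₀ : z₁ : z₂] = jB (conj (z₀/z₁), σ (z₂/z₁))`               on `{|z₀| < |z₁|}`

is well defined (the two formulas agree on the overlap by the surgery relation with
`u = a/|a|`, `t = 1/|a|`, `a = z₁/z₀`, because `R_u σ(z₂/z₁) = σ(z₂/(z₀|a|))`), continuous,
and injective on `ℂℙ² ∖ {[0:0:1]}`; by invariance of domain (Brouwer 1911; the tree's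
`Literature.Topology.Euclidean.Brouwer.isOpen_image_of_injOn`, read in charts:
`isOpenEmbedding_of_continuous_injective_of_chartedSpace`) it is an open embedding of the
4-manifold `ℂℙ² ∖ {pt}` into the 4-manifold `P`.  The sibling file
`ProjectivePlaneSummandOdd.lean` then gives the oddness of the intersection form of every
`ℤ`-orientation of `P` (collapse `P → ℂℙ²` of degree `±1`, `Q_{ℂℙ²} = ⟨±1⟩`).

Everything here is PROVED; the definitions are explicit maps; no named fact is introduced.

## References

* R. C. Kirby, *The Topology of 4-Manifolds*, LNM 1374 (1989), Ch. I §3 p. 10, Ch. VIII p. 50,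
  Ch. X p. 55 (held: `book:kirby1989-topology-4-manifolds`). [Kirby1989]
* R. E. Gompf, A. I. Stipsicz, *4-Manifolds and Kirby Calculus*, GSM 20 (1999), §1.2 (Ex. 1.2.1,
  intersection forms of `ℂℙ²` and of connected sums), §5.2 (surgery on circles, the two framings,
  `S² ×~ S²`). [GompfStipsicz1999]
* L. E. J. Brouwer, *Beweis der Invarianz des `n`-dimensionalen Gebiets*, Math. Ann. 71 (1911),
  305–313. [Brouwer1911b]
-/

open scoped Manifold ContDiff Topology ComplexConjugate
open Set Function Metric

universe u

noncomputable section

namespace Literature.Topology.FourManifolds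

/-- Local notation: `𝔼 n` is the model Euclidean space `EuclideanSpace ℝ (Fin n)`. -/
local notation "𝔼 " n:arg => EuclideanSpace ℝ (Fin n)

/-- Local notation: `𝕊 n` is the unit sphere in `EuclideanSpace ℝ (Fin (n + 1))`. -/
local notation "𝕊 " n:arg => (Metric.sphere (0 : EuclideanSpace ℝ (Fin (n + 1))) 1)

/-! ### Invariance of domain for maps between topological manifolds -/

/-- **Invariance of domain for topological manifolds**: a continuous injection between topological
`n`-manifolds (charted on `ℝⁿ`) is an open embedding (Brouwer 1911; read in charts from the
Euclidean statement `Literature.Topology.Euclidean.Brouwer.isOpen_image_of_injOn`).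
[cite: Brouwer1911b, Satz 1] -/
theorem isOpenEmbedding_of_continuous_injective_of_chartedSpace {n : ℕ} {M N : Type*}
    [TopologicalSpace M] [ChartedSpace (𝔼 n) M] [TopologicalSpace N] [ChartedSpace (𝔼 n) N]
    {f : M → N} (hf : Continuous f) (hinj : Injective f) : Topology.IsOpenEmbedding f := by
  refine Topology.IsOpenEmbedding.of_continuous_injective_isOpenMap hf hinj ?_
  rw [isOpenMap_iff_nhds_le]
  intro x
  -- charts at `x` and at `f x`
  set e := chartAt (𝔼 n) x with he
  set e' := chartAt (𝔼 n) (f x) with he'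
  rw [Filter.le_map_iff]
  intro O hO
  -- shrink `O` to an open set inside both chart domains
  obtain ⟨O', hO'O, hO'open, hxO'⟩ := mem_nhds_iff.1 hO
  set W : Set M := O' ∩ e.source ∩ f ⁻¹' e'.source with hW
  have hWopen : IsOpen W := (hO'open.inter e.open_source).inter (e'.open_source.preimage hf)
  have hxW : x ∈ W := ⟨⟨hxO', mem_chart_source _ x⟩, mem_chart_source _ (f x)⟩
  -- the map read in the charts, on the open set `e '' W`
  set F : 𝔼 n → 𝔼 n := fun z => e' (f (e.symm z)) with hF
  have hWs : W ⊆ e.source := fun z hz => hz.1.2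
  have heW : IsOpen (e '' W) := e.isOpen_image_of_subset_source hWopen hWs
  have hsub : e '' W ⊆ e.target := by
    rw [← e.image_source_eq_target]; exact image_mono hWs
  have hFc : ContinuousOn F (e '' W) := by
    refine e'.continuousOn.comp (hf.comp_continuousOn (e.continuousOn_symm.mono hsub)) ?_
    rintro _ ⟨z, hz, rfl⟩
    show f (e.symm (e z)) ∈ e'.source
    rw [e.left_inv (hWs hz)]
    exact hz.2
  have hFinj : InjOn F (e '' W) := by
    rintro _ ⟨z, hz, rfl⟩ _ ⟨z', hz', rfl⟩ h
    simp only [hF, e.left_inv (hWs hz), e.left_inv (hWs hz')] at h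
    have h2 := e'.injOn hz.2 hz'.2 h
    rw [hinj h2]
  have hFo : IsOpen (F '' (e '' W)) := Euclidean.Brouwer.isOpen_image_of_injOn rfl heW hFc hFinj
  -- `f '' W = e'.symm '' (F '' (e '' W))` is open
  have hFW : F '' (e '' W) ⊆ e'.target := by
    rintro _ ⟨_, ⟨z, hz, rfl⟩, rfl⟩
    simp only [hF, e.left_inv (hWs hz)]
    exact e'.map_source hz.2
  have himage : f '' W = e'.symm '' (F '' (e '' W)) := by
    ext y
    constructor
    · rintro ⟨z, hz, rfl⟩
      refine ⟨F (e z), ⟨e z, ⟨z, hz, rfl⟩, rfl⟩, ?_⟩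
      simp only [hF, e.left_inv (hWs hz), e'.left_inv hz.2]
    · rintro ⟨_, ⟨_, ⟨z, hz, rfl⟩, rfl⟩, rfl⟩
      refine ⟨z, hz, ?_⟩
      simp only [hF, e.left_inv (hWs hz), e'.left_inv hz.2]
  have hfW : IsOpen (f '' W) := by
    rw [himage]
    exact e'.symm.isOpen_image_of_subset_source hFo (by rwa [e'.symm_source])
  exact Filter.mem_of_superset (hfW.mem_nhds ⟨x, hxW, rfl⟩)
    (image_mono fun z hz => hO'O hz.1.1)

namespace TwistedSurgery

open StdCircleSurgery OpLoop

/-! ### Continuity of maps into `ℝ²`, `ℝ³`, `ℝ⁴` given by coordinates -/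

section Vec

variable {α : Type*} [TopologicalSpace α] {f₀ f₁ f₂ f₃ : α → ℝ}

/-- A map into `ℝ²` with continuous coordinates is continuous. [folklore] -/
theorem continuous_vec2 (h₀ : Continuous f₀) (h₁ : Continuous f₁) :
    Continuous fun x => (!₂[f₀ x, f₁ x] : 𝔼 2) := by
  refine (PiLp.continuous_toLp 2 _).comp (continuous_pi fun i => ?_)
  fin_cases i
  · simpa using h₀
  · simpa using h₁

/-- A map into `ℝ³` with continuous coordinates is continuous. [folklore] -/
theorem continuous_vec3 (h₀ : Continuous f₀) (h₁ : Continuous f₁) (h₂ : Continuous f₂) :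
    Continuous fun x => (!₂[f₀ x, f₁ x, f₂ x] : 𝔼 3) := by
  refine (PiLp.continuous_toLp 2 _).comp (continuous_pi fun i => ?_)
  fin_cases i
  · simpa using h₀
  · simpa using h₁
  · simpa using h₂

/-- A map into `ℝ⁴` with continuous coordinates is continuous. [folklore] -/
theorem continuous_vec4 (h₀ : Continuous f₀) (h₁ : Continuous f₁) (h₂ : Continuous f₂)
    (h₃ : Continuous f₃) : Continuous fun x => (!₂[f₀ x, f₁ x, f₂ x, f₃ x] : 𝔼 4) := by
  refine (PiLp.continuous_toLp 2 _).comp (continuous_pi fun i => ?_)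
  fin_cases i
  · simpa using h₀
  · simpa using h₁
  · simpa using h₂
  · simpa using h₃

end Vec

/-! ### The complex plane as `𝔼 2`, and the inverse stereographic projection `σ : ℂ → S² ∖ {e₂}` -/

/-- A complex number as a point of `ℝ²` (the same three-line map as the topic-level `toE2` of
`FishtailCapEnd.lean`, restated in the model namespace so as not to import the mapping-torus
closure of that file into the surgery files). [folklore] -/
def toE2 (z : ℂ) : 𝔼 2 := !₂[z.re, z.im]

/-- Coordinate `0` of `toE2 z` is the real part. [folklore] -/
@[simp] theorem toE2_apply_zero (z : ℂ) : toE2 z 0 = z.re := rfl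

/-- Coordinate `1` of `toE2 z` is the imaginary part. [folklore] -/
@[simp] theorem toE2_apply_one (z : ℂ) : toE2 z 1 = z.im := rfl

/-- `‖toE2 z‖ = ‖z‖`. [folklore] -/
private theorem norm_toE2 (z : ℂ) : ‖toE2 z‖ = ‖z‖ := by
  have h1 : ‖toE2 z‖ ^ 2 = z.re ^ 2 + z.im ^ 2 := norm_sq_vec2 _ _
  have h2 : ‖z‖ ^ 2 = z.re ^ 2 + z.im ^ 2 := by
    rw [Complex.sq_norm, Complex.normSq_apply]; ring
  nlinarith [norm_nonneg (toE2 z), norm_nonneg z, sq_nonneg (‖toE2 z‖ - ‖z‖),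
    sq_nonneg (‖toE2 z‖ + ‖z‖)]

/-- `toE2` is real-linear: scalars. [folklore] -/
theorem toE2_smul (t : ℝ) (z : ℂ) : toE2 (t • z) = t • toE2 z := by
  ext i; fin_cases i <;> simp [toE2]

/-- `toE2` is injective. [folklore] -/
theorem toE2_injective : Injective toE2 := fun z w h => by
  apply Complex.ext
  · simpa using congrArg (fun v : 𝔼 2 => v 0) h
  · simpa using congrArg (fun v : 𝔼 2 => v 1) h

/-- `toE2 0 = 0`. [folklore] -/
@[simp] theorem toE2_zero : toE2 0 = 0 := by
  ext i; fin_cases i <;> simp [toE2]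

/-- `toE2 z = 0 ↔ z = 0`. [folklore] -/
private theorem toE2_eq_zero_iff {z : ℂ} : toE2 z = 0 ↔ z = 0 := by
  rw [← toE2_zero]; exact toE2_injective.eq_iff

/-- `toE2` is continuous. [folklore] -/
theorem continuous_toE2 : Continuous toE2 :=
  continuous_vec2 Complex.continuous_re Complex.continuous_im

/-- **The inverse stereographic projection from the north pole `e₂`**:
`σ ζ = (2 Re ζ, 2 Im ζ, |ζ|² - 1)/(|ζ|² + 1) ∈ S²` (`σ 0 = -e₂`, `σ ζ ≠ e₂`). [folklore] -/
def sig (ζ : ℂ) : 𝔼 3 := (1 + Complex.normSq ζ)⁻¹ • !₂[2 * ζ.re, 2 * ζ.im, Complex.normSq ζ - 1]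

/-- `0 < 1 + |ζ|²`. [folklore] -/
theorem one_add_normSq_pos (ζ : ℂ) : 0 < 1 + Complex.normSq ζ := by
  have := Complex.normSq_nonneg ζ; linarith

/-- Coordinate `0` of `σ ζ`. [folklore] -/
theorem sig_apply_zero (ζ : ℂ) : sig ζ 0 = 2 * ζ.re / (1 + Complex.normSq ζ) := by
  simp [sig, smul_vec3]; ring

/-- Coordinate `1` of `σ ζ`. [folklore] -/
theorem sig_apply_one (ζ : ℂ) : sig ζ 1 = 2 * ζ.im / (1 + Complex.normSq ζ) := by
  simp [sig, smul_vec3]; ring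

/-- Coordinate `2` of `σ ζ`. [folklore] -/
theorem sig_apply_two (ζ : ℂ) : sig ζ 2 = (Complex.normSq ζ - 1) / (1 + Complex.normSq ζ) := by
  simp [sig, smul_vec3]; ring

/-- `σ ζ` lies on the unit sphere. [folklore] -/
theorem norm_sig (ζ : ℂ) : ‖sig ζ‖ = 1 := by
  have hd := one_add_normSq_pos ζ
  have h : ‖sig ζ‖ ^ 2 = 1 := by
    rw [norm_sq_three, sig_apply_zero, sig_apply_one, sig_apply_two]
    rw [Complex.normSq_apply]
    field_simp
    ring
  nlinarith [norm_nonneg (sig ζ)]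

/-- The height of `σ ζ` is `< 1`: `σ` misses the north pole. [folklore] -/
theorem sig_apply_two_lt_one (ζ : ℂ) : sig ζ 2 < 1 := by
  rw [sig_apply_two, div_lt_one (one_add_normSq_pos ζ)]
  linarith

/-- `0 < 1 - (σ ζ)₂`. [folklore] -/
theorem one_sub_sig_two_pos (ζ : ℂ) : 0 < 1 - sig ζ 2 := by
  have := sig_apply_two_lt_one ζ; linarith

/-- **Stereographic projection recovers `ζ`**: `(σ₀, σ₁)/(1 - σ₂) = (Re ζ, Im ζ)`. [folklore] -/
theorem sig_div_one_sub (ζ : ℂ) :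
    sig ζ 0 / (1 - sig ζ 2) = ζ.re ∧ sig ζ 1 / (1 - sig ζ 2) = ζ.im := by
  have hd := one_add_normSq_pos ζ
  have h2 : 1 - sig ζ 2 = 2 / (1 + Complex.normSq ζ) := by
    rw [sig_apply_two]; field_simp; ring
  rw [h2, sig_apply_zero, sig_apply_one]
  constructor <;> · field_simp

/-- `σ` is injective. [folklore] -/
theorem sig_injective : Injective sig := by
  intro ζ ζ' h
  have h1 := sig_div_one_sub ζ
  have h2 := sig_div_one_sub ζ'
  rw [h] at h1
  exact Complex.ext (h1.1.symm.trans h2.1) (h1.2.symm.trans h2.2)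

/-- `σ` is continuous. [folklore] -/
theorem continuous_sig : Continuous sig := by
  have hc : Continuous fun ζ : ℂ => (1 + Complex.normSq ζ)⁻¹ :=
    (continuous_const.add Complex.continuous_normSq).inv₀ fun ζ => (one_add_normSq_pos ζ).ne'
  exact hc.smul (continuous_vec3 (continuous_const.mul Complex.continuous_re)
    (continuous_const.mul Complex.continuous_im) (Complex.continuous_normSq.sub continuous_const))

/-- `σ ζ` as a point of the unit sphere `S²`. [folklore] -/
def sigS (ζ : ℂ) : 𝕊 2 := ⟨sig ζ, by simp [norm_sig]⟩

/-- The underlying vector of `sigS ζ`. [folklore] -/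
@[simp] theorem coe_sigS (ζ : ℂ) : (sigS ζ : 𝔼 3) = sig ζ := rfl

/-- `sigS` is continuous. [folklore] -/
theorem continuous_sigS : Continuous sigS := continuous_sig.subtype_mk _

/-- `sigS` is injective. [folklore] -/
theorem sigS_injective : Injective sigS := fun _ _ h => sig_injective (congrArg Subtype.val h)

/-- **Equivariance**: the rotation of the `(w₀, w₁)`-plane by the angle of `u ∈ S¹` carries
`σ ζ` to `σ (u ζ)` (`u` read as a unit complex number). [folklore] -/
theorem mulVecE_rotMat_sig (u : 𝕊 1) (ζ : ℂ) :
    mulVecE (rotMat (u : 𝔼 2)) (sig ζ) = sig ((⟨(u : 𝔼 2) 0, (u : 𝔼 2) 1⟩ : ℂ) * ζ) := by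
  have hu := sq_add_sq_of_mem_sphere u
  have hu' : (u : 𝔼 2) 0 * (u : 𝔼 2) 0 + (u : 𝔼 2) 1 * (u : 𝔼 2) 1 = 1 := by
    rw [← sq, ← sq]; exact hu
  have hn : Complex.normSq ((⟨(u : 𝔼 2) 0, (u : 𝔼 2) 1⟩ : ℂ) * ζ) = Complex.normSq ζ := by
    rw [Complex.normSq_mul, Complex.normSq_mk, hu']; simp
  ext i
  rw [mulVecE_apply, Fin.sum_univ_three]
  fin_cases i
  · simp [rotMat, sig_apply_zero, sig_apply_one, sig_apply_two, hn, Complex.mul_re]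
    ring
  · simp [rotMat, sig_apply_zero, sig_apply_one, sig_apply_two, hn, Complex.mul_im]
    ring
  · simp [rotMat, sig_apply_zero, sig_apply_one, sig_apply_two, hn]

/-! ### The map `Φ : ℂ² → ℝ⁴ ∖ C₁` -/

/-- The fibre parameter `β = b / max (1, |a|)`. [folklore] -/
def beta (a b : ℂ) : ℂ := (max 1 ‖a‖)⁻¹ • b

/-- The denominator `√(1 + |a|²) - (σ β)₂ > 0` of `Φ`. [folklore] -/
def den (a b : ℂ) : ℝ := √(1 + ‖a‖ ^ 2) - sig (beta a b) 2

/-- **The map `Φ`**: `Φ (a, b) = (Re a, Im a, σ₀, σ₁)/(√(1 + |a|²) - σ₂)`, `σ = σ (b / max (1, |a|))`.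
[folklore] -/
def Phi (a b : ℂ) : 𝔼 4 :=
  (den a b)⁻¹ • !₂[a.re, a.im, sig (beta a b) 0, sig (beta a b) 1]

/-- `1 ≤ max (1, |a|)`. [folklore] -/
theorem one_le_max (a : ℂ) : (1 : ℝ) ≤ max 1 ‖a‖ := le_max_left _ _

/-- `1 ≤ √(1 + |a|²)`. [folklore] -/
theorem one_le_sqrt (a : ℂ) : (1 : ℝ) ≤ √(1 + ‖a‖ ^ 2) := by
  calc (1 : ℝ) = √1 := Real.sqrt_one.symm
    _ ≤ √(1 + ‖a‖ ^ 2) := Real.sqrt_le_sqrt (by nlinarith [norm_nonneg a])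

/-- The denominator of `Φ` is positive. [folklore] -/
theorem den_pos (a b : ℂ) : 0 < den a b := by
  have h1 := one_le_sqrt a
  have h2 := sig_apply_two_lt_one (beta a b)
  unfold den; linarith

/-- Coordinates of `Φ`. [folklore] -/
theorem Phi_apply (a b : ℂ) :
    Phi a b 0 = a.re / den a b ∧ Phi a b 1 = a.im / den a b ∧
      Phi a b 2 = sig (beta a b) 0 / den a b ∧ Phi a b 3 = sig (beta a b) 1 / den a b := by
  simp only [Phi, smul_vec4, vec4_apply_zero, vec4_apply_one, vec4_apply_two, vec4_apply_three]
  refine ⟨?_, ?_, ?_, ?_⟩ <;> ring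

/-- `Φ` is continuous. [folklore] -/
theorem continuous_Phi : Continuous fun p : ℂ × ℂ => Phi p.1 p.2 := by
  have hm : Continuous fun p : ℂ × ℂ => ((max 1 ‖p.1‖)⁻¹ : ℝ) :=
    (continuous_const.max (continuous_norm.comp continuous_fst)).inv₀
      fun p => (lt_of_lt_of_le one_pos (one_le_max p.1)).ne'
  have hβ : Continuous fun p : ℂ × ℂ => beta p.1 p.2 := hm.smul continuous_snd
  have hσ : Continuous fun p : ℂ × ℂ => sig (beta p.1 p.2) := continuous_sig.comp hβ
  have hσi : ∀ i, Continuous fun p : ℂ × ℂ => sig (beta p.1 p.2) i := fun i =>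
    (PiLp.continuous_apply 2 _ i).comp hσ
  have hden : Continuous fun p : ℂ × ℂ => den p.1 p.2 := by
    refine Continuous.sub ?_ (hσi 2)
    exact (continuous_const.add ((continuous_norm.comp continuous_fst).pow 2)).sqrt
  exact (hden.inv₀ fun p => (den_pos p.1 p.2).ne').smul
    (continuous_vec4 (Complex.continuous_re.comp continuous_fst)
      (Complex.continuous_im.comp continuous_fst) (hσi 0) (hσi 1))

/-- `Φ (0, b) = (0, 0, Re b, Im b)`: on the fibre over the centre of the disc `Φ` is the normal
plane. [folklore] -/
theorem Phi_zero (b : ℂ) : Phi 0 b = !₂[0, 0, b.re, b.im] := by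
  have hβ : beta 0 b = b := by simp [beta]
  have hden : den 0 b = 1 - sig b 2 := by simp [den, hβ]
  obtain ⟨h0, h1, h2, h3⟩ := Phi_apply 0 b
  have hs := sig_div_one_sub b
  ext i
  fin_cases i
  · simp [h0]
  · simp [h1]
  · simp only [Fin.reduceFinMk]; rw [h2, hβ, hden, hs.1]; rfl
  · simp only [Fin.reduceFinMk]; rw [h3, hβ, hden, hs.2]; rfl

/-- The `(ζ₀, ζ₁)`-part of `Φ (a, b)` is `a / den`. [folklore] -/
theorem xPart_Phi (a b : ℂ) : StdCircleSurgery.xPart (Phi a b) = (den a b)⁻¹ • toE2 a := by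
  obtain ⟨h0, h1, -, -⟩ := Phi_apply a b
  ext i
  fin_cases i
  · simp [StdCircleSurgery.xPart, h0, toE2, div_eq_inv_mul]
  · simp [StdCircleSurgery.xPart, h1, toE2, div_eq_inv_mul]

/-- `√(1 + |a|⁻²) = √(1 + |a|²)/|a|` for `a ≠ 0` (the norm of `|a|⁻¹ σ` in the tube
denominator). [folklore] -/
theorem sqrt_one_add_inv_sq {r : ℝ} (hr : 0 < r) : √(1 + (r⁻¹) ^ 2) = r⁻¹ * √(1 + r ^ 2) := by
  have h : 1 + (r⁻¹) ^ 2 = (r⁻¹) ^ 2 * (1 + r ^ 2) := by field_simp; ring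
  rw [h, Real.sqrt_mul (sq_nonneg _), Real.sqrt_sq (inv_nonneg.2 hr.le)]

/-- **`Φ` is a tube point off the centre**: for `a ≠ 0`,
`Φ (a, b) = tubeMap (a/|a|, |a|⁻¹ σ(β))`. [folklore] -/
theorem Phi_eq_tubeMap {a : ℂ} (ha : a ≠ 0) (b : ℂ) :
    Phi a b = tubeMap (‖a‖⁻¹ • toE2 a, ‖a‖⁻¹ • sig (beta a b)) := by
  have hr : 0 < ‖a‖ := norm_pos_iff.2 ha
  have hr' : ‖a‖ ≠ 0 := hr.ne'
  set s := sig (beta a b) with hs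
  have hns : ‖‖a‖⁻¹ • s‖ = ‖a‖⁻¹ := by
    rw [norm_smul, norm_inv, norm_norm, hs, norm_sig]; simp
  have hden' : tubeDen (‖a‖⁻¹ • s) = ‖a‖⁻¹ * den a b := by
    rw [tubeDen, hns, sqrt_one_add_inv_sq hr, den, PiLp.smul_apply, smul_eq_mul]
    ring
  have hd := den_pos a b
  ext i
  fin_cases i
  · simp only [Fin.zero_eta, Fin.isValue]
    rw [(Phi_apply a b).1, tubeMap_apply_zero, hden']
    simp [toE2]
    field_simp
  · simp only [Fin.mk_one, Fin.isValue]
    rw [(Phi_apply a b).2.1, tubeMap_apply_one, hden']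
    simp [toE2]
    field_simp
  · simp only [Fin.reduceFinMk, Fin.isValue]
    rw [(Phi_apply a b).2.2.1, tubeMap_apply_two, hden', ← hs]
    simp
    field_simp
  · simp only [Fin.reduceFinMk, Fin.isValue]
    rw [(Phi_apply a b).2.2.2, tubeMap_apply_three, hden', ← hs]
    simp
    field_simp

/-- The unit vector `a/|a| ∈ S¹` of a nonzero complex number. [folklore] -/
def unitOf (a : ℂ) (ha : a ≠ 0) : 𝕊 1 :=
  ⟨‖a‖⁻¹ • toE2 a, by
    rw [mem_sphere_zero_iff_norm, norm_smul, norm_inv, norm_norm, norm_toE2,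
      inv_mul_cancel₀ (norm_ne_zero_iff.2 ha)]⟩

/-- The underlying vector of `unitOf a`. [folklore] -/
@[simp] theorem coe_unitOf (a : ℂ) (ha : a ≠ 0) : (unitOf a ha : 𝔼 2) = ‖a‖⁻¹ • toE2 a := rfl

/-- `|a/|a|| = 1` as a vector of `ℝ²`. [folklore] -/
theorem norm_inv_smul_toE2 {a : ℂ} (ha : a ≠ 0) : ‖‖a‖⁻¹ • toE2 a‖ = 1 := by
  rw [norm_smul, norm_inv, norm_norm, norm_toE2, inv_mul_cancel₀ (norm_ne_zero_iff.2 ha)]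

/-- **`Φ` is injective.** [folklore] -/
theorem Phi_injective {a b a' b' : ℂ} (h : Phi a b = Phi a' b') : a = a' ∧ b = b' := by
  -- the `(ζ₀, ζ₁)`-parts: `a / den = a' / den'`
  have hx : (den a b)⁻¹ • toE2 a = (den a' b')⁻¹ • toE2 a' := by
    rw [← xPart_Phi, ← xPart_Phi, h]
  have hd := den_pos a b
  have hd' := den_pos a' b'
  by_cases ha : a = 0
  · -- over the centre: `Φ (0, b) = (0, 0, b)`
    subst ha
    have ha' : a' = 0 := by
      have h0 : (den a' b')⁻¹ • toE2 a' = 0 := by rw [← hx, toE2_zero, smul_zero]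
      rcases smul_eq_zero.1 h0 with h0 | h0
      · exact absurd h0 (inv_ne_zero hd'.ne')
      · exact toE2_eq_zero_iff.1 h0
    subst ha'
    refine ⟨rfl, ?_⟩
    rw [Phi_zero, Phi_zero] at h
    apply Complex.ext
    · simpa using congrArg (fun v : 𝔼 4 => v 2) h
    · simpa using congrArg (fun v : 𝔼 4 => v 3) h
  · have ha' : a' ≠ 0 := by
      rintro rfl
      have h0 : (den a b)⁻¹ • toE2 a = 0 := by rw [hx, toE2_zero, smul_zero]
      rcases smul_eq_zero.1 h0 with h0 | h0
      · exact absurd h0 (inv_ne_zero hd.ne')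
      · exact ha (toE2_eq_zero_iff.1 h0)
    -- off the centre both are tube points; invert the tube
    set q : (𝔼 2) × (𝔼 3) := (‖a‖⁻¹ • toE2 a, ‖a‖⁻¹ • sig (beta a b)) with hqdef
    set q' : (𝔼 2) × (𝔼 3) := (‖a'‖⁻¹ • toE2 a', ‖a'‖⁻¹ • sig (beta a' b')) with hq'def
    have hq1 : ‖q.1‖ = 1 := norm_inv_smul_toE2 ha
    have hq'1 : ‖q'.1‖ = 1 := norm_inv_smul_toE2 ha'
    have hq : q = q' := by
      have h' : tubeMap q = tubeMap q' := by rw [← Phi_eq_tubeMap ha, ← Phi_eq_tubeMap ha', h]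
      rw [← tubeInv_tubeMap q hq1, ← tubeInv_tubeMap q' hq'1, h']
    have h1 : ‖a‖⁻¹ • toE2 a = ‖a'‖⁻¹ • toE2 a' := congrArg Prod.fst hq
    have h2 : ‖a‖⁻¹ • sig (beta a b) = ‖a'‖⁻¹ • sig (beta a' b') := congrArg Prod.snd hq
    -- norms of the fibre parts: `|a| = |a'|`
    have hn : ‖a‖ = ‖a'‖ := by
      have := congrArg (fun w : 𝔼 3 => ‖w‖) h2
      simp only [norm_smul, norm_inv, norm_norm, norm_sig] at this
      exact inv_injective (by simpa using this)
    have haa : a = a' := by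
      rw [hn] at h1
      exact toE2_injective (smul_right_injective (𝔼 2) (inv_ne_zero (norm_ne_zero_iff.2 ha')) h1)
    refine ⟨haa, ?_⟩
    rw [hn] at h2
    have hs : sig (beta a b) = sig (beta a' b') :=
      smul_right_injective (𝔼 3) (inv_ne_zero (norm_ne_zero_iff.2 ha')) h2
    have hβ := sig_injective hs
    rw [beta, beta, hn] at hβ
    exact smul_right_injective ℂ (inv_ne_zero (lt_of_lt_of_le one_pos (one_le_max a')).ne') hβ

/-- **`Φ` avoids the standard circle `C₁`.** [folklore] -/
theorem not_onCircle_Phi (a b : ℂ) : ¬ OnCircle (Phi a b) := by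
  rintro ⟨h2, h3, hn⟩
  obtain ⟨e0, e1, e2, e3⟩ := Phi_apply a b
  have hd := den_pos a b
  -- the fibre direction is `-e₂`: `β = 0`
  have hs0 : sig (beta a b) 0 = 0 := by
    rw [e2, div_eq_zero_iff] at h2
    exact h2.resolve_right hd.ne'
  have hs1 : sig (beta a b) 1 = 0 := by
    rw [e3, div_eq_zero_iff] at h3
    exact h3.resolve_right hd.ne'
  have hβ : beta a b = 0 := by
    have hp := one_add_normSq_pos (beta a b)
    rw [sig_apply_zero, div_eq_zero_iff] at hs0
    rw [sig_apply_one, div_eq_zero_iff] at hs1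
    apply Complex.ext
    · simpa using hs0.resolve_right hp.ne'
    · simpa using hs1.resolve_right hp.ne'
  have hden : den a b = √(1 + ‖a‖ ^ 2) + 1 := by
    rw [den, hβ, sig_apply_two, map_zero]; ring
  -- `|Φ|² = |a|²/den² < 1`
  rw [norm_sq_four, e0, e1, h2, h3] at hn
  have ha2 : a.re ^ 2 + a.im ^ 2 = ‖a‖ ^ 2 := by
    rw [Complex.sq_norm, Complex.normSq_apply]; ring
  have hlt : ‖a‖ < den a b := by
    rw [hden]
    have : ‖a‖ ≤ √(1 + ‖a‖ ^ 2) := by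
      conv_lhs => rw [← Real.sqrt_sq (norm_nonneg a)]
      exact Real.sqrt_le_sqrt (by linarith)
    linarith
  have hsum : (a.re / den a b) ^ 2 + (a.im / den a b) ^ 2 = ‖a‖ ^ 2 / den a b ^ 2 := by
    rw [← ha2]; field_simp
  rw [hsum] at hn
  have h1 : ‖a‖ ^ 2 / den a b ^ 2 < 1 := by
    rw [div_lt_one (by positivity)]
    nlinarith [norm_nonneg a]
  linarith

/-- **Over the closed unit disc `Φ` stays outside the open unit tube**: for `|a| ≤ 1`, `Φ (a, b)`
is not a tube point `tubeMap (u, w)` with `|w| < 1`. [folklore] -/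
theorem Phi_ne_tubeMap_of_norm_le_one {a : ℂ} (ha : ‖a‖ ≤ 1) (b : ℂ) (u : 𝕊 1) {w : 𝔼 3}
    (hw : ‖w‖ < 1) : Phi a b ≠ tubeMap ((u : 𝔼 2), w) := by
  intro h
  have hu1 : ‖((u : 𝔼 2), w).1‖ = 1 := by simp [norm_eq_of_mem_sphere u]
  by_cases ha0 : a = 0
  · subst ha0
    have h0 : StdCircleSurgery.xPart (Phi 0 b) = 0 := by rw [xPart_Phi, toE2_zero, smul_zero]
    rw [h] at h0
    exact xPart_tubeMap_ne_zero _ hu1 h0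
  · set q : (𝔼 2) × (𝔼 3) := (‖a‖⁻¹ • toE2 a, ‖a‖⁻¹ • sig (beta a b)) with hqdef
    have hq1 : ‖q.1‖ = 1 := norm_inv_smul_toE2 ha0
    have hq : q = ((u : 𝔼 2), w) := by
      have h' : tubeMap q = tubeMap ((u : 𝔼 2), w) := by rw [← Phi_eq_tubeMap ha0, h]
      rw [← tubeInv_tubeMap q hq1, ← tubeInv_tubeMap _ hu1, h']
    have h2' : ‖a‖⁻¹ • sig (beta a b) = w := congrArg Prod.snd hq
    have h2 : ‖‖a‖⁻¹ • sig (beta a b)‖ = ‖w‖ := by rw [h2']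
    rw [norm_smul, norm_inv, norm_norm, norm_sig] at h2
    have : 1 ≤ ‖a‖⁻¹ := (one_le_inv₀ (norm_pos_iff.2 ha0)).2 ha
    have h2'' : ‖a‖⁻¹ = ‖w‖ := by simpa using h2
    linarith

/-! ### The twisted tube of a chart: the surgery relation at the points `Φ (a, b)`, `|a| > 1` -/

/-- The generator `twist` of `π₁ SO(3)` acts on the fibre by the rotation matrix `rotMat u`.
[folklore] -/
theorem twist_toFun_apply (u : 𝕊 1) (w : 𝔼 3) :
    OpLoop.twist.toFun u w = mulVecE (rotMat (u : 𝔼 2)) w :=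
  matCLM_apply _ _

/-- The unit complex number of `a/|a|` times `b/a` is `b/|a|`. [folklore] -/
theorem unitComplex_mul_div {a : ℂ} (ha : a ≠ 0) (b : ℂ) :
    (⟨(unitOf a ha : 𝔼 2) 0, (unitOf a ha : 𝔼 2) 1⟩ : ℂ) * (b / a) = (‖a‖⁻¹ : ℝ) • b := by
  have h : (⟨(unitOf a ha : 𝔼 2) 0, (unitOf a ha : 𝔼 2) 1⟩ : ℂ) = (‖a‖⁻¹ : ℝ) • a := by
    apply Complex.ext <;> simp [toE2]
  rw [h, smul_mul_assoc, ← mul_div_assoc, mul_div_cancel_left₀ b ha]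

/-- For `|a| > 1` the fibre parameter is `β = b/|a|`. [folklore] -/
theorem beta_eq_of_one_lt {a : ℂ} (ha : 1 < ‖a‖) (b : ℂ) : beta a b = (‖a‖⁻¹ : ℝ) • b := by
  rw [beta, max_eq_right ha.le]

/-- `conj (a⁻¹) = a/|a|²` read in `ℝ²`: the disc coordinate `conj (z₀/z₁)` is `t • u` with
`u = a/|a|`, `t = 1/|a|`, `a = z₁/z₀`. [folklore] -/
theorem toE2_conj_inv {a : ℂ} (ha : a ≠ 0) :
    toE2 (conj a⁻¹) = ‖a‖⁻¹ • ((unitOf a ha : 𝕊 1) : 𝔼 2) := by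
  have hn : Complex.normSq a = ‖a‖ ^ 2 := Complex.normSq_eq_norm_sq a
  have hr : ‖a‖ ≠ 0 := norm_ne_zero_iff.2 ha
  ext i
  fin_cases i
  · simp [toE2, Complex.inv_re, hn]
    field_simp
  · simp [toE2, Complex.inv_im, hn]
    field_simp

/-- The point `(conj a', σ b')` of `ℝ² × S²` (the `D̊² × S²` branch before `jB`). [folklore] -/
def bTwo (w : Fin 2 → ℂ) : (𝔼 2) × (𝕊 2) := (toE2 (conj (w 0)), sigS (w 1))

/-- `bTwo w` lies in `D̊² × S²` iff `|w₀| < 1`. [folklore] -/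
theorem bTwo_mem_iff (w : Fin 2 → ℂ) : bTwo w ∈ discTimesSphere ↔ ‖w 0‖ < 1 := by
  rw [mem_discTimesSphere_iff, bTwo, norm_toE2, Complex.norm_conj]

section Chart

variable {X : Type u} [TopologicalSpace X] [T2Space X] [ChartedSpace (𝔼 4) X]
  [IsManifold (𝓡 4) ∞ X] (C : StdChart X)

/-- The complement of the core circle does not depend on the framing of the tube. [folklore] -/
theorem complement_linTwist (L : OpLoop) : (C.nbhd.linTwist L).complement = C.nbhd.complement := rfl

/-- `C.igPH (Φ (a, b))` lies off the standard circle of the chart. [folklore] -/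
theorem igPH_Phi_mem (a b : ℂ) : C.igPH (Phi a b) ∈ (C.nbhd.linTwist OpLoop.twist).complement :=
  (C.igPH_mem_complement_iff _).2 (not_onCircle_Phi a b)

omit [T2Space X] in
/-- **The twisted tube at `(a/|a|, |a|⁻¹ σ(b/a))` is the chart point `Φ (a, b)`** (`|a| > 1`):
`ν (u, t v) = C.igPH (tubeMap (u, t R_u v))` and `R_u σ(b/a) = σ(b/|a|)`. [folklore] -/
theorem linTwist_apply_unitOf {a : ℂ} (ha : 1 < ‖a‖) (b : ℂ) (ha0 : a ≠ 0) :
    (C.nbhd.linTwist OpLoop.twist).toFun (unitOf a ha0, ‖a‖⁻¹ • sig (b / a)) =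
      C.igPH (Phi a b) := by
  rw [CircleNbhd.linTwist_apply, StdChart.nbhd_toFun_apply, StdChart.igPH_apply, Phi_eq_tubeMap ha0]
  congr 2
  rw [stdTube]
  congr 1
  refine Prod.ext rfl ?_
  change OpLoop.twist.toFun (unitOf a ha0) (‖a‖⁻¹ • sig (b / a)) = ‖a‖⁻¹ • sig (beta a b)
  rw [map_smul, twist_toFun_apply, mulVecE_rotMat_sig, unitComplex_mul_div ha0,
    beta_eq_of_one_lt ha]

/-- **The surgery relation at `Φ (a, b)`, `|a| > 1`**: the chart point `C.igPH (Φ (a, b))` of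
`X ∖ c` and the point `(conj a⁻¹, σ(b/a))` of `D̊² × S²` are identified by the gluing of the
twisted surgery. [cite: GompfStipsicz1999, §5.2] -/
theorem circleSurgeryRel_Phi {a : ℂ} (ha : 1 < ‖a‖) (b : ℂ)
    (x : ↥(C.nbhd.linTwist OpLoop.twist).complement) (y : ↥discTimesSphere)
    (hx : (x : X) = C.igPH (Phi a b)) (hy1 : (y : (𝔼 2) × (𝕊 2)).1 = toE2 (conj a⁻¹))
    (hy2 : (y : (𝔼 2) × (𝕊 2)).2 = sigS (b / a)) :
    circleSurgeryRel (C.nbhd.linTwist OpLoop.twist) x y := by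
  have ha0 : a ≠ 0 := by rintro rfl; simp at ha; linarith
  have hr : 0 < ‖a‖ := norm_pos_iff.2 ha0
  refine ⟨unitOf a ha0, ‖a‖⁻¹, ⟨inv_pos.2 hr, inv_lt_one_of_one_lt₀ ha⟩, ?_, ?_⟩
  · rw [hy1, toE2_conj_inv ha0]
  · rw [hx, hy2, coe_sigS, linTwist_apply_unitOf C ha b ha0]

end Chart

/-! ### The map `ℂℙ² ∖ {[0:0:1]} → P` -/

section Map

open ComplexProjectiveSpace

/-- The chart-`0` domain `O₁ = {z₀ ≠ 0}` of `ℂℙ²`. [folklore] -/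
def O₁ : Set ComplexProjectivePlane := {p | CoordNeZero 0 p}

/-- The domain `O₂ = {|z₀| < |z₁|}` of the `D̊² × S²` branch. [folklore] -/
def O₂ : Set ComplexProjectivePlane := {p | CoordNeZero 1 p ∧ ‖affineCoordComplex 1 p 0‖ < 1}

/-- Affine coordinates of chart `0` of `ℂℙ²`: `(z₁/z₀, z₂/z₀)`. [folklore] -/
theorem affineCoordComplex_zero_mk (v : {v : Fin 3 → ℂ // v ≠ 0}) :
    affineCoordComplex (n := 2) 0 (mk v) 0 = (v : Fin 3 → ℂ) 1 / (v : Fin 3 → ℂ) 0 ∧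
      affineCoordComplex (n := 2) 0 (mk v) 1 = (v : Fin 3 → ℂ) 2 / (v : Fin 3 → ℂ) 0 := by
  simp [affineCoordComplex_mk]

/-- Affine coordinates of chart `1` of `ℂℙ²`: `(z₀/z₁, z₂/z₁)`. [folklore] -/
theorem affineCoordComplex_one_mk (v : {v : Fin 3 → ℂ // v ≠ 0}) :
    affineCoordComplex (n := 2) 1 (mk v) 0 = (v : Fin 3 → ℂ) 0 / (v : Fin 3 → ℂ) 1 ∧
      affineCoordComplex (n := 2) 1 (mk v) 1 = (v : Fin 3 → ℂ) 2 / (v : Fin 3 → ℂ) 1 := by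
  simp [affineCoordComplex_mk]

/-- `bTwo` is continuous. [folklore] -/
theorem continuous_bTwo : Continuous bTwo :=
  (continuous_toE2.comp (Complex.continuous_conj.comp (continuous_apply 0))).prodMk
    (continuous_sigS.comp (continuous_apply 1))

/-- The complex affine coordinates of `ℂℙ²` are continuous on their chart domain. [folklore] -/
theorem continuousOn_affineCoordComplex (i : Fin 3) :
    ContinuousOn (affineCoordComplex (n := 2) i) {p | CoordNeZero i p} := by
  refine continuousOn_of_comp_mk (isOpen_setOf_coordNeZero i) (continuousOn_pi.2 fun j => ?_)
  exact (((continuous_apply _).comp continuous_subtype_val).continuousOn).div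
    (((continuous_apply _).comp continuous_subtype_val).continuousOn) fun v hv => hv

/-- `O₁` is open. [folklore] -/
theorem isOpen_O₁ : IsOpen O₁ := isOpen_setOf_coordNeZero 0

/-- `O₂` is open. [folklore] -/
theorem isOpen_O₂ : IsOpen O₂ :=
  (((continuous_apply 0).comp_continuousOn (continuousOn_affineCoordComplex 1)).norm).isOpen_inter_preimage
    (isOpen_setOf_coordNeZero 1) isOpen_Iio

/-- Points of `ℂℙ²` with the same affine coordinates in a common chart are equal. [folklore] -/
theorem eq_of_affineCoordComplex_eq {i : Fin 3} {p q : ComplexProjectivePlane} (hp : CoordNeZero i p)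
    (hq : CoordNeZero i q) (h : affineCoordComplex i p = affineCoordComplex i q) : p = q := by
  apply (affineChart (n := 2) i).injOn (show p ∈ (affineChart i).source from hp)
    (show q ∈ (affineChart i).source from hq)
  show realCoordinates 2 (affineCoordComplex i p) = realCoordinates 2 (affineCoordComplex i q)
  rw [h]

/-- A point of `ℂℙ² ∖ {[0:0:1]}` lies in `O₁` or in `O₂`. [folklore] -/
theorem mem_O₁_or_O₂ {p : ComplexProjectivePlane} (hp : p ≠ center (n := 1) 2) : p ∈ O₁ ∨ p ∈ O₂ := by
  obtain ⟨v, rfl⟩ := mk_surjective p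
  by_cases h0 : (v : Fin 3 → ℂ) 0 = 0
  · right
    have hoff : OffCenter 2 (mk v) := (offCenter_iff_ne_center 2 _).2 hp
    rw [offCenter_mk] at hoff
    have h1 : (v : Fin 3 → ℂ) 1 ≠ 0 := by
      intro h1
      apply hoff
      funext j
      fin_cases j
      · simpa [Fin.removeNth] using h0
      · show (v : Fin 3 → ℂ) ((2 : Fin 3).succAbove 1) = 0
        exact h1
    refine ⟨h1, ?_⟩
    show ‖affineCoordComplex (n := 2) 1 (mk v) 0‖ < 1
    rw [(affineCoordComplex_one_mk v).1, h0, zero_div, norm_zero]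
    exact one_pos
  · exact Or.inl h0

variable {X : Type u} [TopologicalSpace X] [T2Space X] [ChartedSpace (𝔼 4) X]
  [IsManifold (𝓡 4) ∞ X] (C : StdChart X)
  {P : Type u} [TopologicalSpace P] [ChartedSpace (𝔼 4) P]
  (jA : ↥(C.nbhd.linTwist OpLoop.twist).complement → P) (jB : ↥discTimesSphere → P)

/-- **The branch over the chart `{z₀ ≠ 0}`**: `(a, b) ↦ jA (C.igPH (Φ (a, b)))`. [folklore] -/
def jOne (w : Fin 2 → ℂ) : P := jA ⟨C.igPH (Phi (w 0) (w 1)), igPH_Phi_mem C (w 0) (w 1)⟩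

open Classical in
/-- **The map `J : ℂℙ² → P`** (junk at `[0:0:1]`): the chart-`0` branch where `z₀ ≠ 0`, the
`D̊² × S²` branch where `z₀ = 0` (and, by `J_eq_jB`, on all of `{|z₀| < |z₁|}`). [folklore] -/
def J (p : ComplexProjectivePlane) : P :=
  if CoordNeZero 0 p then jOne C jA (affineCoordComplex 0 p)
  else if h : ‖affineCoordComplex 1 p 0‖ < 1 then
    jB ⟨bTwo (affineCoordComplex 1 p), (bTwo_mem_iff _).2 h⟩
  else jOne C jA 0

omit [ChartedSpace (𝔼 4) P] in
/-- `jOne` is continuous when `jA` is. [folklore] -/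
theorem continuous_jOne (hA : Continuous jA) : Continuous (jOne C jA) := by
  have hig : Continuous C.igPH := by
    have h := C.igPH.continuousOn
    rw [C.igPH_source] at h
    exact continuousOn_univ.1 h
  have h0 : Continuous fun w : Fin 2 → ℂ => ((w 0, w 1) : ℂ × ℂ) :=
    (continuous_apply 0).prodMk (continuous_apply 1)
  have h1 : Continuous fun w : Fin 2 → ℂ => Phi (w 0) (w 1) :=
    continuous_Phi.comp (f := fun w : Fin 2 → ℂ => ((w 0, w 1) : ℂ × ℂ)) h0
  have h2 : Continuous fun w : Fin 2 → ℂ => C.igPH (Phi (w 0) (w 1)) :=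
    hig.comp (f := fun w : Fin 2 → ℂ => Phi (w 0) (w 1)) h1
  have h3 : Continuous fun w : Fin 2 → ℂ =>
      (⟨C.igPH (Phi (w 0) (w 1)), igPH_Phi_mem C (w 0) (w 1)⟩ :
        ↥(C.nbhd.linTwist OpLoop.twist).complement) :=
    h2.subtype_mk fun w => igPH_Phi_mem C (w 0) (w 1)
  exact hA.comp (f := fun w : Fin 2 → ℂ =>
      (⟨C.igPH (Phi (w 0) (w 1)), igPH_Phi_mem C (w 0) (w 1)⟩ :
        ↥(C.nbhd.linTwist OpLoop.twist).complement)) h3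

omit [TopologicalSpace P] [ChartedSpace (𝔼 4) P] in
/-- `jOne` is injective when `jA` is (`Φ` and the chart are injective). [folklore] -/
theorem jOne_injective (hA : Injective jA) : Injective (jOne C jA) := by
  intro w w' h
  have h1 : C.igPH (Phi (w 0) (w 1)) = C.igPH (Phi (w' 0) (w' 1)) := congrArg Subtype.val (hA h)
  have h2 : Phi (w 0) (w 1) = Phi (w' 0) (w' 1) :=
    C.igPH.injOn (by rw [C.igPH_source]; trivial) (by rw [C.igPH_source]; trivial) h1
  obtain ⟨h3, h4⟩ := Phi_injective h2
  funext j
  fin_cases j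
  · exact h3
  · exact h4

omit [TopologicalSpace P] [ChartedSpace (𝔼 4) P] in
/-- On `O₁ = {z₀ ≠ 0}` the map `J` is the chart-`0` branch. [folklore] -/
theorem J_eq_jOne {p : ComplexProjectivePlane} (hp : CoordNeZero 0 p) :
    J C jA jB p = jOne C jA (affineCoordComplex 0 p) := by
  unfold J; rw [if_pos hp]

variable {jA jB}
variable (hP : IsOpenGluingWith (𝓡 4) (𝓘(ℝ, 𝔼 2).prod (𝓡 2)) (𝓡 4)
  (A := (C.nbhd.linTwist OpLoop.twist).complement) (B := discTimesSphere)
  (circleSurgeryRel (C.nbhd.linTwist OpLoop.twist)) jA jB)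

include hP in
/-- **The two branches agree on the overlap `{z₀ ≠ 0, |z₀| < |z₁|}`** (the surgery relation,
`circleSurgeryRel_Phi`, at `a = z₁/z₀`, `b = z₂/z₀`). [cite: GompfStipsicz1999, §5.2] -/
theorem jOne_eq_jB (v : {v : Fin 3 → ℂ // v ≠ 0}) (h0 : (v : Fin 3 → ℂ) 0 ≠ 0)
    (hlt : ‖(v : Fin 3 → ℂ) 0‖ < ‖(v : Fin 3 → ℂ) 1‖)
    (hmem : bTwo (affineCoordComplex (n := 2) 1 (mk v)) ∈ discTimesSphere) :
    jOne C jA (affineCoordComplex 0 (mk v)) = jB ⟨bTwo (affineCoordComplex 1 (mk v)), hmem⟩ := by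
  set a : ℂ := (v : Fin 3 → ℂ) 1 / (v : Fin 3 → ℂ) 0 with ha_def
  set b : ℂ := (v : Fin 3 → ℂ) 2 / (v : Fin 3 → ℂ) 0 with hb_def
  have ha : 1 < ‖a‖ := by
    rw [ha_def, norm_div, one_lt_div (norm_pos_iff.2 h0)]; exact hlt
  refine (hP.2.2.2.2.2 _ _).2 (circleSurgeryRel_Phi C ha b _ _ ?_ ?_ ?_)
  · show C.igPH (Phi (affineCoordComplex (n := 2) 0 (mk v) 0) (affineCoordComplex (n := 2) 0 (mk v) 1)) = _
    rw [(affineCoordComplex_zero_mk v).1, (affineCoordComplex_zero_mk v).2]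
  · show toE2 (conj (affineCoordComplex (n := 2) 1 (mk v) 0)) = _
    rw [(affineCoordComplex_one_mk v).1, ha_def, inv_div]
  · show sigS (affineCoordComplex (n := 2) 1 (mk v) 1) = _
    rw [(affineCoordComplex_one_mk v).2, ha_def, hb_def, div_div_div_cancel_right₀ h0]

include hP in
/-- **On `O₂ = {|z₀| < |z₁|}` the map `J` is the `D̊² × S²` branch.** [folklore] -/
theorem J_eq_jB {p : ComplexProjectivePlane} (hp : p ∈ O₂) :
    J C jA jB p = jB ⟨bTwo (affineCoordComplex 1 p), (bTwo_mem_iff _).2 hp.2⟩ := by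
  obtain ⟨v, rfl⟩ := mk_surjective p
  have h1 : (v : Fin 3 → ℂ) 1 ≠ 0 := hp.1
  by_cases h0 : (v : Fin 3 → ℂ) 0 = 0
  · have hn : ¬ CoordNeZero 0 (mk v) := fun h => h h0
    unfold J
    rw [if_neg hn, dif_pos hp.2]
  · have hlt : ‖(v : Fin 3 → ℂ) 0‖ < ‖(v : Fin 3 → ℂ) 1‖ := by
      have h := hp.2
      rw [(affineCoordComplex_one_mk v).1, norm_div, div_lt_one (norm_pos_iff.2 h1)] at h
      exact h
    rw [J_eq_jOne C jA jB (show CoordNeZero 0 (mk v) from h0)]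
    exact jOne_eq_jB C hP v h0 hlt _

include hP in
/-- **Continuity of `J` off `[0:0:1]`** (the open cover `O₁`, `O₂`). [folklore] -/
theorem continuousOn_J : ContinuousOn (J C jA jB) ({center (n := 1) 2}ᶜ) := by
  have hA : Continuous jA := hP.1.isEmbedding.continuous
  have hB : Continuous jB := hP.2.2.1.isEmbedding.continuous
  have h₁ : ContinuousOn (J C jA jB) O₁ :=
    ((continuous_jOne C jA hA).comp_continuousOn (continuousOn_affineCoordComplex 0)).congr
      fun p hp => J_eq_jOne C jA jB hp
  have h₂ : ContinuousOn (J C jA jB) O₂ := by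
    rw [continuousOn_iff_continuous_restrict]
    have hac : Continuous fun p : O₂ => affineCoordComplex (n := 2) 1 (p : ComplexProjectivePlane) :=
      (continuousOn_affineCoordComplex 1).comp_continuous continuous_subtype_val fun p => p.2.1
    have h : Continuous fun p : O₂ =>
        jB ⟨bTwo (affineCoordComplex (n := 2) 1 (p : ComplexProjectivePlane)), (bTwo_mem_iff _).2 p.2.2⟩ :=
      hB.comp ((continuous_bTwo.comp hac).subtype_mk _)
    convert h using 1
    funext p
    exact J_eq_jB C hP p.2
  intro p hp
  rcases mem_O₁_or_O₂ hp with h | h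
  · exact (h₁.continuousAt (isOpen_O₁.mem_nhds h)).continuousWithinAt
  · exact (h₂.continuousAt (isOpen_O₂.mem_nhds h)).continuousWithinAt

include hP in
/-- A point of the belt sphere `jB (0, s)` is not in the image of `jA`. [folklore] -/
theorem jB_zero_ne_jA (s : 𝕊 2) (h : (((0 : 𝔼 2), s) : (𝔼 2) × (𝕊 2)) ∈ discTimesSphere)
    (x : ↥(C.nbhd.linTwist OpLoop.twist).complement) : jB ⟨((0 : 𝔼 2), s), h⟩ ≠ jA x := by
  intro heq
  obtain ⟨u, t, ht, h1, -⟩ := (hP.2.2.2.2.2 x _).1 heq.symm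
  have hne : t • (u : 𝔼 2) ≠ 0 := smul_ne_zero ht.1.ne' (ne_zero_of_mem_unit_sphere u)
  exact hne h1.symm

include hP in
/-- **Normal form of `J` over `{z₀ = 0}`**: for `p ≠ [0:0:1]` with `z₀ = 0`, `p` lies in the
chart `{z₁ ≠ 0}`, has first coordinate `0` there, and `J p = jB (0, σ(z₂/z₁))`. [folklore] -/
theorem J_eq_of_not_coordNeZero {p : ComplexProjectivePlane} (hp : p ≠ center (n := 1) 2)
    (hp0 : ¬ CoordNeZero 0 p) :
    CoordNeZero 1 p ∧ affineCoordComplex 1 p 0 = 0 ∧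
      ∃ h, J C jA jB p = jB ⟨((0 : 𝔼 2), sigS (affineCoordComplex 1 p 1)), h⟩ := by
  have hO : p ∈ O₂ := (mem_O₁_or_O₂ hp).resolve_left hp0
  obtain ⟨v, rfl⟩ := mk_surjective p
  have h0 : (v : Fin 3 → ℂ) 0 = 0 := by
    by_contra h; exact hp0 h
  have hac0 : affineCoordComplex (n := 2) 1 (mk v) 0 = 0 := by
    rw [(affineCoordComplex_one_mk v).1, h0, zero_div]
  have hmem : (((0 : 𝔼 2), sigS (affineCoordComplex (n := 2) 1 (mk v) 1)) : (𝔼 2) × (𝕊 2)) ∈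
      discTimesSphere := by
    rw [mem_discTimesSphere_iff]; simp
  refine ⟨hO.1, hac0, hmem, ?_⟩
  rw [J_eq_jB C hP hO]
  congr 1
  apply Subtype.ext
  show bTwo (affineCoordComplex (n := 2) 1 (mk v)) = _
  rw [bTwo, hac0, map_zero, toE2_zero]

include hP in
/-- **Injectivity of `J` off `[0:0:1]`.** [folklore] -/
theorem injOn_J : InjOn (J C jA jB) ({center (n := 1) 2}ᶜ) := by
  have hA : Injective jA := hP.1.isEmbedding.injective
  have hB : Injective jB := hP.2.2.1.isEmbedding.injective
  intro p hp q hq h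
  by_cases hp0 : CoordNeZero 0 p <;> by_cases hq0 : CoordNeZero 0 q
  · rw [J_eq_jOne C jA jB hp0, J_eq_jOne C jA jB hq0] at h
    exact eq_of_affineCoordComplex_eq hp0 hq0 (jOne_injective C jA hA h)
  · obtain ⟨-, -, hm, hJ⟩ := J_eq_of_not_coordNeZero C hP hq hq0
    rw [J_eq_jOne C jA jB hp0, hJ] at h
    exact absurd h.symm (jB_zero_ne_jA C hP _ hm _)
  · obtain ⟨-, -, hm, hJ⟩ := J_eq_of_not_coordNeZero C hP hp hp0
    rw [J_eq_jOne C jA jB hq0, hJ] at h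
    exact absurd h (jB_zero_ne_jA C hP _ hm _)
  · obtain ⟨hp1, hpa, hm, hJ⟩ := J_eq_of_not_coordNeZero C hP hp hp0
    obtain ⟨hq1, hqa, hm', hJ'⟩ := J_eq_of_not_coordNeZero C hP hq hq0
    rw [hJ, hJ'] at h
    have h2 := congrArg (fun y : ↥discTimesSphere => (y : (𝔼 2) × (𝕊 2)).2) (hB h)
    have h3 : affineCoordComplex (n := 2) 1 p 1 = affineCoordComplex (n := 2) 1 q 1 :=
      sigS_injective h2
    refine eq_of_affineCoordComplex_eq hp1 hq1 ?_
    funext j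
    fin_cases j
    · exact hpa.trans hqa.symm
    · exact h3

/-- The punctured projective plane `ℂℙ² ∖ {[0:0:1]}` as an open subset of `ℂℙ²`. [folklore] -/
def puncturedPlane : TopologicalSpace.Opens ComplexProjectivePlane :=
  ⟨{center (n := 1) 2}ᶜ, isOpen_compl_singleton⟩

include hP in
/-- **The twisted surgery contains `ℂℙ² ∖ {pt}` as an open subset**: for every open gluing `P`
of `X ∖ c` and `D̊² × S²` along the surgery relation of the twisted standard tube of a chart,
the restriction of `J` to `ℂℙ² ∖ {[0:0:1]}` is an open embedding into `P` (continuous and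
injective between 4-manifolds, hence open by invariance of domain). [cite: GompfStipsicz1999, §5.2] [cite: Brouwer1911b, Satz 1] -/
theorem exists_isOpenEmbedding_puncturedProjectivePlane :
    ∃ j : ↥(({center (n := 1) 2}ᶜ : Set ComplexProjectivePlane)) → P, Topology.IsOpenEmbedding j := by
  haveI : ChartedSpace (𝔼 4) ↥(({center (n := 1) 2}ᶜ : Set ComplexProjectivePlane)) :=
    inferInstanceAs (ChartedSpace (𝔼 4) (puncturedPlane : TopologicalSpace.Opens ComplexProjectivePlane))
  refine ⟨({center (n := 1) 2}ᶜ : Set ComplexProjectivePlane).restrict (J C jA jB), ?_⟩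
  exact isOpenEmbedding_of_continuous_injective_of_chartedSpace (n := 4)
    (continuousOn_iff_continuous_restrict.1 (continuousOn_J C hP))
    (injOn_iff_injective.1 (injOn_J C hP))

end Map


end TwistedSurgery

/-! ### The twisted surgery has an odd intersection form -/

section Odd

open Literature.AlgebraicTopology.SingularHomology ComplexProjectiveSpace TwistedSurgery

/-- **Every presentation of the twisted surgery has an odd intersection form**: if `P` is an
open gluing of `X ∖ c` and `D̊² × S²` along the surgery relation of the twisted standard tube
`C.nbhd.linTwist twist` of a chart of the closed smooth 4-manifold `X`, then the intersection
form of every `ℤ`-orientation of `P` is odd (`P` contains `ℂℙ² ∖ {pt}` as an open subset,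
`exists_isOpenEmbedding_puncturedProjectivePlane`, and such 4-manifolds are odd,
`isOdd_intersectionForm_of_isOpenEmbedding_puncturedProjectivePlane`). Gompf–Stipsicz 1999,
§5.2 with §1.2: `X # S² ×~ S² ≅ X # ℂℙ² # \overline{ℂℙ²}` is odd.
[cite: GompfStipsicz1999, §5.2 and §1.2] [cite: Kirby1989, Ch. I §3 p. 10 and Ch. VIII p. 50] -/
theorem isOdd_intersectionForm_of_isOpenGluingWith_twist {X : Type} [TopologicalSpace X]
    [T2Space X] [ChartedSpace (𝔼 4) X] [IsManifold (𝓡 4) ∞ X] (C : StdChart X) {P : Type}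
    [TopologicalSpace P] [T2Space P] [CompactSpace P] [ChartedSpace (𝔼 4) P]
    {jA : ↥(C.nbhd.linTwist OpLoop.twist).complement → P} {jB : ↥discTimesSphere → P}
    (hP : IsOpenGluingWith (𝓡 4) (𝓘(ℝ, 𝔼 2).prod (𝓡 2)) (𝓡 4)
      (A := (C.nbhd.linTwist OpLoop.twist).complement) (B := discTimesSphere)
      (circleSurgeryRel (C.nbhd.linTwist OpLoop.twist)) jA jB)
    (μ : HomologicalOrientation ℤ P 4) : (intersectionForm two_add_two_eq_four μ).IsOdd := by
  obtain ⟨j, hj⟩ := exists_isOpenEmbedding_puncturedProjectivePlane C hP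
  exact isOdd_intersectionForm_of_isOpenEmbedding_puncturedProjectivePlane j hj μ

/-- **The twisted surgery `(C.nbhd.linTwist twist).Surgered` of a closed smooth 4-manifold has
an odd intersection form, for every `ℤ`-orientation** — the local input `hodd` of the parity
route to Wall's stabilisation theorem (`HCobordismEvenLevels.lean`): the twisted level passage
`V ↦ V # S² ×~ S²` (Kirby 1989, Ch. VIII p. 50) cannot occur between even levels.
[cite: GompfStipsicz1999, §5.2 and §1.2] [cite: Kirby1989, Ch. VIII p. 50 and Ch. X p. 55] -/
theorem isOdd_intersectionForm_twistSurgered {X : Type} [TopologicalSpace X] [T2Space X]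
    [CompactSpace X] [ChartedSpace (𝔼 4) X] [IsManifold (𝓡 4) ∞ X] (C : StdChart X)
    (μ : HomologicalOrientation ℤ (C.nbhd.linTwist OpLoop.twist).Surgered 4) :
    (intersectionForm two_add_two_eq_four μ).IsOdd := by
  obtain ⟨jA, jB, hP⟩ := isOpenGluing_iff.1 (C.nbhd.linTwist OpLoop.twist).isOpenGluing_surgered
  exact isOdd_intersectionForm_of_isOpenGluingWith_twist C hP μ

end Odd


end Literature.Topology.FourManifolds

end
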